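import Summits.QuantumAdvantage.QuantumAdvantage.Theorems.SosSandwichTransferPBWalkMachine
import Summits.QuantumAdvantage.QuantumAdvantage.Theorems.SosSandwichTransferPBDescentWalk
import HarnessLib

/-!
# Crux `TransferPB` (stmt-QuantumAdvantage-15238, route SosSandwich), line `birth` — the reference transcript machine asks polynomially many queries

Round budget of the machine half (M_str) of stub `stub_pbOracleSimulation`, for the reference machine
`walkMachine Wf Df` (`Theorems/SosSandwichTransferPBWalkMachineDefs.lean`, correctness `run_walkMachine` in
`Theorems/SosSandwichTransferPBWalkMachine.lean`):

* `queryCount_filterComp`, `queryCount_flatMapComp`, `queryCount_askG/askA` — counting laws;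
* `queryCount_liveComp_le` (`≤ 1 + 2·j·B`), `queryCount_candsComp_le` (`≤ W·(1+2·W·B) + W·B`),
  `queryCount_walkComp_le` (`≤ D·(W·(1+2·W·B) + W·B + 1)` along any invariant bounding the levels by `B` and
  preserved by the walk's steps), `queryCount_meansComp` (`≤ 40`), `queryCount_machineComp_le`;
* `length_eval_liveComp_le`, `strPath_step` — under an answer function CONSISTENT with `nodeProblem F r c k` the
  invariant "the path is an index path `strPath F x ρ`" works with `B = 8T²·2^k·(400·d·(r(n)+1))^c`
  (`Theorems/SosSandwichTransferPBDescentBound.lean`, `…DescentWidth.lean`: any width bound `W' ≥ W` is fine);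
* **`queryCount_machineComp_le_of_consistent`** — hence the reference machine asks at most
  `D·(W'·(1 + 2·W'·B) + W'·B + 1) + 40` queries: polynomial in `n` for polynomial `W' = Wf x ≥ oracleWidth F x`,
  `D = Df x`, `T`, `r(n)`.

With `run_walkMachine` this discharges the RUN and ROUND-BUDGET clauses of (M_str) for the reference machine; the
remaining content of the machine half is `OracleAlg.IsPolyTime` (of this machine, or of any machine with the same
runs) and the query-LENGTH bound. All proved; no named fact.
Sources: C. H. Bennett, E. Bernstein, G. Brassard, U. Vazirani, SIAM J. Comput. 26 (1997), Cor. 3.4;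
S. Aaronson, A. Ambainis, Theory Comput. 10 (2014), proof of Thm. 23 (p. 14).
-/

-- D-0017: single-conjunct summit ⇒ the duplicate `QuantumAdvantage.QuantumAdvantage` is mandated.
set_option linter.dupNamespace false

noncomputable section

namespace Summit.QuantumAdvantage.QuantumAdvantage.Cruxes.TransferPB.Birth

open Finset Literature.Computability.Cryptography Literature.Computability.Complexity
  Literature.Computability.QuantumComplexity Literature.Computability.QuantumComplexity.ClassicalSimulation

namespace SimTreePB

section Count

variable {α β : Type} (O : Oracle)

/-- Queries of `filterComp` add up. [folklore] -/
theorem queryCount_filterComp (p : α → OracleComp Bool) (l : List α) :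
    OracleComp.queryCount O (filterComp p l) = (l.map fun a => OracleComp.queryCount O (p a)).sum := by
  induction l with
  | nil => rfl
  | cons a l ih => simp [filterComp, ih]

/-- Queries of `flatMapComp` add up. [folklore] -/
theorem queryCount_flatMapComp (f : α → OracleComp (List β)) (l : List α) :
    OracleComp.queryCount O (flatMapComp f l) = (l.map fun a => OracleComp.queryCount O (f a)).sum := by
  induction l with
  | nil => rfl
  | cons a l ih => simp [flatMapComp, ih]

/-- `askG` asks one query. [folklore] -/
@[simp] theorem queryCount_askG (v : List Bool) : OracleComp.queryCount O (askG v) = 1 := by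
  simp [askG, OracleComp.ask]

/-- `askA` asks one query. [folklore] -/
@[simp] theorem queryCount_askA (u : List Bool) : OracleComp.queryCount O (askA u) = 1 := by
  simp [askA, OracleComp.ask]

/-- A sum of constants over a list. [folklore] -/
theorem sum_map_const_le {γ : Type} (l : List γ) (f : γ → ℕ) {B : ℕ} (h : ∀ a ∈ l, f a ≤ B) :
    (l.map f).sum ≤ l.length * B := by
  induction l with
  | nil => simp
  | cons a l ih =>
    simp only [List.map_cons, List.sum_cons, List.length_cons, Nat.succ_mul]
    have h1 := h a (by simp)
    have h2 := ih fun a' ha' => h a' (by simp [ha'])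
    omega

variable (x : List Bool)

/-- **Queries of the level computation**: `≤ 1 + 2·j·B` when every level has at most `B` members. [folklore] -/
theorem queryCount_liveComp_le (π : List (List Bool × Bool)) {B : ℕ}
    (hB : ∀ i : ℕ, (OracleComp.eval O (liveComp x π i)).length ≤ B) :
    ∀ j : ℕ, OracleComp.queryCount O (liveComp x π j) ≤ 1 + 2 * j * B
  | 0 => by simp [liveComp]
  | j + 1 => by
    have ih := queryCount_liveComp_le π hB j
    have hlen := hB j
    simp only [liveComp, OracleComp.queryCount_bind, queryCount_flatMapComp, queryCount_filterComp,
      queryCount_askG, List.map_cons, List.map_nil, List.sum_cons, List.sum_nil]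
    have hsum : ((OracleComp.eval O (liveComp x π j)).map fun _ : List Bool => (1 + (1 + 0) : ℕ)).sum =
        (OracleComp.eval O (liveComp x π j)).length * 2 := by
      rw [List.map_const', List.sum_replicate, smul_eq_mul]
    rw [hsum]
    nlinarith

/-- **Queries of the candidate computation**: `≤ W·(1 + 2·W·B) + W·B`. [folklore] -/
theorem queryCount_candsComp_le (π : List (List Bool × Bool)) (W : ℕ) {B : ℕ}
    (hB : ∀ i : ℕ, (OracleComp.eval O (liveComp x π i)).length ≤ B) :
    OracleComp.queryCount O (candsComp x π W) ≤ W * (1 + 2 * W * B) + W * B := by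
  simp only [candsComp, OracleComp.queryCount_bind, queryCount_flatMapComp, queryCount_filterComp,
    OracleComp.queryCount_pure, queryCount_askG, eval_flatMapComp, add_zero]
  have h1 : ((List.range W).map fun j => OracleComp.queryCount O (liveComp x π j)).sum ≤ W * (1 + 2 * W * B) := by
    have := sum_map_const_le (List.range W) (fun j => OracleComp.queryCount O (liveComp x π j)) (B := 1 + 2 * W * B)
      fun j hj => (queryCount_liveComp_le O x π hB j).trans (by
        have : j ≤ W := (List.mem_range.1 hj).le
        nlinarith)
    simpa using this
  have h2 : (((List.range W).flatMap fun j => OracleComp.eval O (liveComp x π j)).map fun _ : List Bool => (1 : ℕ)).sum ≤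
      W * B := by
    rw [List.map_const', List.sum_replicate, smul_eq_mul, mul_one, List.length_flatMap]
    have := sum_map_const_le (List.range W) (fun j => (OracleComp.eval O (liveComp x π j)).length) fun j _ => hB j
    simpa using this
  omega

/-- **Queries of the walk** along paths satisfying an invariant `Good` that bounds the levels by `B` and is
preserved by the walk's steps: `≤ D·(W·(1 + 2·W·B) + W·B + 1)`. [folklore] -/
theorem queryCount_walkComp_le (W : ℕ) {B : ℕ} (Good : List (List Bool × Bool) → Prop)
    (hB : ∀ π, Good π → ∀ i : ℕ, (OracleComp.eval O (liveComp x π i)).length ≤ B)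
    (hstep : ∀ π, Good π → ∀ u : List Bool, (OracleComp.eval O (candsComp x π W)).argmin strNum = some u →
      ∀ b : Bool, Good (π ++ [(u, b)])) :
    ∀ (D : ℕ) (π : List (List Bool × Bool)), Good π →
      OracleComp.queryCount O (walkComp x W D π) ≤ D * (W * (1 + 2 * W * B) + W * B + 1)
  | 0, π, _ => by simp [walkComp]
  | D + 1, π, hπ => by
    have hc := queryCount_candsComp_le O x π W (hB π hπ)
    simp only [walkComp, OracleComp.queryCount_bind]
    cases hu : (OracleComp.eval O (candsComp x π W)).argmin strNum with
    | none =>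
      simp only [OracleComp.queryCount_pure, add_zero]
      nlinarith
    | some u =>
      simp only [OracleComp.queryCount_bind, queryCount_askA]
      have ih := queryCount_walkComp_le W Good hB hstep D (π ++ [(u, OracleComp.eval O (askA u))])
        (hstep π hπ u hu _)
      nlinarith

/-- The forty MEAN queries. [folklore] -/
theorem queryCount_meansComp (π : List (List Bool × Bool)) : OracleComp.queryCount O (meansComp x π) ≤ 40 := by
  unfold meansComp
  have h := OracleComp.queryCount_forEach_le O (fun j => askG (encMeanS x π j)) (Icc 1 40).toList (B := 1)
    fun j _ => (queryCount_askG O _).le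
  rw [Finset.length_toList, Nat.card_Icc] at h
  simpa using h

/-- **Queries of the whole machine computation** along a preserved invariant: `≤ D·(W·(1+2·W·B) + W·B + 1) + 40`.
[folklore] -/
theorem queryCount_machineComp_le (Wf Df : List Bool → ℕ) {B : ℕ} (Good : List (List Bool × Bool) → Prop)
    (hB : ∀ π, Good π → ∀ i : ℕ, (OracleComp.eval O (liveComp x π i)).length ≤ B)
    (hstep : ∀ π, Good π → ∀ u : List Bool, (OracleComp.eval O (candsComp x π (Wf x))).argmin strNum = some u →
      ∀ b : Bool, Good (π ++ [(u, b)]))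
    (h0 : Good []) :
    OracleComp.queryCount O (machineComp Wf Df x) ≤
      Df x * (Wf x * (1 + 2 * Wf x * B) + Wf x * B + 1) + 40 := by
  simp only [machineComp, OracleComp.queryCount_bind, OracleComp.queryCount_pure, add_zero]
  have h1 := queryCount_walkComp_le O x (Wf x) Good hB hstep (Df x) [] h0
  have h2 := queryCount_meansComp O x (OracleComp.eval O (walkComp x (Wf x) (Df x) []))
  omega

end Count

/-! ### The invariant under consistency: index paths -/

section Consistent

variable {F : QCircuitFamily cliffordT} {x : List Bool} {r : Polynomial ℕ} {c k : ℕ} {g : List Bool → Bool}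
  {inA : List Bool → Bool} {O : Oracle}

/-- Under consistency every live level at an index path has at most `8T²·2^k·(400·d·(r(n)+1))^c` members
(in the reference machine's evaluation). [cite: BennettBernsteinBrassardVazirani1997, Cor. 3.4] -/
theorem length_eval_liveComp_le (hO : ∀ v : List Bool, Computability.decodeBool (O (true :: v)) = g v)
    (hgn : ∀ v ∈ (nodeProblem F r c k).no, g v = false) (ρ : List (Fin (numOracleBits F x) × Bool)) (i : ℕ) :
    (OracleComp.eval O (liveComp x (strPath F x ρ) i)).length ≤
      8 * (F.circ x.length).oracleQueries ^ 2 * 2 ^ k * (400 * thm23Degree F x * (r.eval x.length + 1)) ^ c := by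
  rw [eval_liveComp hO]
  have hb : (fun u => g (encBlockS x (strPath F x ρ) u)) = fun u => g (encBlock F x ρ u) :=
    funext fun u => by rw [encBlock_eq_encBlockS]
  rw [hb]
  have h := length_liveLevel_le hgn ρ i
  rw [liveBound_eq] at h
  exact_mod_cast h

/-- Under consistency a pick of the reference machine at an index path (with any width bound `W' ≥ W`) is a
short string, so the extended path is again an index path. [folklore] -/
theorem strPath_step (hO : ∀ v : List Bool, Computability.decodeBool (O (true :: v)) = g v)
    (hgn : ∀ v ∈ (nodeProblem F r c k).no, g v = false) {W' : ℕ} (hW : oracleWidth F x ≤ W')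
    (ρ : List (Fin (numOracleBits F x) × Bool)) {u : List Bool}
    (hu : (OracleComp.eval O (candsComp x (strPath F x ρ) W')).argmin strNum = some u) (b : Bool) :
    ∃ ρ' : List (Fin (numOracleBits F x) × Bool), strPath F x ρ ++ [(u, b)] = strPath F x ρ' := by
  rw [eval_candsComp hO] at hu
  have hb : (fun u => g (encBlockS x (strPath F x ρ) u)) = fun u => g (encBlock F x ρ u) :=
    funext fun u => by rw [encBlock_eq_encBlockS]
  have hd : descentPick (fun u => g (encBlock F x ρ u)) (fun u => g (encSingleS x (strPath F x ρ) u)) W'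
      ((strPath F x ρ).map Prod.fst) = some u := by
    rw [← hb]; exact hu
  rw [descentPick_eq_of_le hgn ρ _ _ hW] at hd
  obtain ⟨hlt, -, -, -⟩ := descentPick_some_spec hd
  exact ⟨ρ ++ [(bitEquiv F x ⟨u, mem_shortStrings.2 hlt⟩, b)], by rw [strPath_append_singleton, bitString_bitEquiv hlt]⟩

/-- **Polynomial query count of the reference machine under consistency.** For every `g` consistent with
`nodeProblem F r c k`, every oracle answering `true :: v` by `g v`, and any width bound `Wf x ≥ oracleWidth F x`,
the reference machine's computation asks at most `D·(W'·(1 + 2·W'·B) + W'·B + 1) + 40` queries, with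
`B = 8T²·2^k·(400·d·(r(n)+1))^c` (`d = thm23Degree F x`) — polynomial in `n` once `W' = Wf x`, `D = Df x`,
`T`, `r(n)` are. [cite: BennettBernsteinBrassardVazirani1997, Cor. 3.4] [cite: AaronsonAmbainis2014, Thm. 23 (proof, p. 14)] -/
theorem queryCount_machineComp_le_of_consistent
    (hO : ∀ v : List Bool, Computability.decodeBool (O (true :: v)) = g v)
    (hgn : ∀ v ∈ (nodeProblem F r c k).no, g v = false) (Wf Df : List Bool → ℕ) (hW : oracleWidth F x ≤ Wf x) :
    OracleComp.queryCount O (machineComp Wf Df x) ≤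
      Df x * (Wf x * (1 + 2 * Wf x * (8 * (F.circ x.length).oracleQueries ^ 2 * 2 ^ k *
          (400 * thm23Degree F x * (r.eval x.length + 1)) ^ c)) +
        Wf x * (8 * (F.circ x.length).oracleQueries ^ 2 * 2 ^ k * (400 * thm23Degree F x * (r.eval x.length + 1)) ^ c) + 1) +
      40 := by
  refine queryCount_machineComp_le O x Wf Df (fun π => ∃ ρ : List (Fin (numOracleBits F x) × Bool), π = strPath F x ρ)
    ?_ ?_ ⟨[], (strPath_nil F x).symm⟩
  · rintro π ⟨ρ, rfl⟩ i
    exact length_eval_liveComp_le hO hgn ρ i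
  · rintro π ⟨ρ, rfl⟩ u hu b
    obtain ⟨ρ', h⟩ := strPath_step hO hgn hW ρ hu b
    exact ⟨ρ', h⟩

end Consistent

end SimTreePB

end Summit.QuantumAdvantage.QuantumAdvantage.Cruxes.TransferPB.Birth

end
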